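import Literature.NumberTheory.EllipticCurves.HeckeCongruenceModulus
import HarnessLib
import HarnessLib.Audit.Tags

/-!
# 2-EISENSTEIN RANK ONE AT LEVEL `4p` IN HECKE-ALGEBRA CURRENCY — E-imc-85ᵀ `FourPTwoEisensteinRankOneT`
# (`𝕋(Γ₀(4p))_{𝔪₂} = ℤ₂`) and (U) = E-imc-85U `FourPTwoEisensteinPacketUniqueT`, with the vocabulary `eisIdealTwo`,
# `IsTwoEisensteinPacketUnique`, `IsTwoEisensteinRankOne` (imc g15 «SketchU», MEMO-imc §21.9 (2); typing with T-imc-8)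
# — cell `bsd-f2-manin` (D-0131 (3) frontier: the Manin constant at additive primes)

HONEST FRAMING.  LENS = IMC / Hecke-algebra multiplicity one at the Eisenstein prime `2` (planner-of-record
`bsd-f2-manin-imc`, g15).  Source: HOME/imc/SketchU-imc-g15.lean sha16 **1b629302bc2a4de9** (farm rc 0; BC7 2/2 CLEAN),
namespace `…Cruxes.ManinOddAtFour.TwoEisensteinRankOne` ↦ `…ManinAdditive.TwoEisenstein` (the sibling of
`TwoEisensteinRankOneLaws.lean`, which carries the ELEMENTARY currency E-imc-85 `FourPTwoEisensteinRankOne` — the line of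
`T_ℓ`-nilpotent vectors in `S₂(Γ₀(4p); 𝔽₂)` — and the rest of imc's §21 rows).  ONE DEVIATION from the source, forced by the
typer lint «cite an existing decl rather than restating a near-duplicate»: imc's local `heckeGenerators N` /
`heckeAlg N := Algebra.adjoin ℤ {T_ℓ : ℓ prime, ℓ ∤ N}` ARE the tree's `anemicHeckeGenerators N 2` / `anemicHeckeRing N 2`
(`Literature/NumberTheory/EllipticCurves/HeckeCongruenceModulus.lean`: Pasten's `𝕋_{1,N}`, with `CommRing`, `Module.Finite ℤ`,
`Module.Free ℤ`, `IsNoetherianRing` instances and `finite_minimalPrimes_anemicHeckeRing` PROVED) — the same term up to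
α-renaming, so every Prop below is imc's VERBATIM with `heckeAlg N` ↦ `anemicHeckeRing N 2`, and the identities
`heckeAlg N = anemicHeckeRing N 2 := rfl`, `imc.FourPTwoEisensteinRankOneT ↔ FourPTwoEisensteinRankOneT := Iff.rfl` (and for
85U, `IsTwoEisensteinRankOne N`) are kernel-checked in HOME/typer/Combined_T_imc_8_hecke_check.scratch.lean (farm rc 0 · 0
warnings).  Nothing here is asserted: the two `@[conjecture]` rows are STATEMENTS (cell candidates, NOT tree facts); the
theorems are definitional edges and refuter-1's read-back lemmas RBU66.1–66.3 (HOME/ref1-CU66-imc-g15-audit.lean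
2606c7fce688f566 rc 0, 0 sorries; refuter-1 hygiene H-2 — imc's file lacked `set_option linter.dupNamespace false` — is moot
in this namespace, which has no repeated component).

WHY THIS CURRENCY (imc 2026-08-28T10:14:09Z, MEMO-imc §21.9 (2)): es's LEMMA-es-30 («idempotent lemma», MEMO-es §28.17)
consumes the uniqueness hypothesis (U) of the 2-Eisenstein system at `4(m² + 4)`; (U)_Zar below is its Zariski form and
E-imc-85ᵀ the full `𝕋_𝔪 = ℤ₂` statement implying it (`fourPTwoEisensteinPacketUniqueT_of_rankOneT`); the C2 LEAD's tame
blind stub 6 (`OddDegreeTooth.RbTotallyBlindTame`) line «two-eisenstein-rank-one» (crux idea on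
stmt-BirchSwinnertonDyer-22967, commit 1dcc86cce347) may take `stub_U` := E-imc-85ᵀ.  The EMB/PROJ (`J₀(N)`-module) currency
of es §28.17 is typable over `ModularJacobianModPMultiplicityOne.J0` but is NOT typed here (T-es-19; es owns it).

BC5 WITNESS (imc census, kit tag bsd, engine HOME/imc/g15-eis2.gp; HOME/imc/g15-eis2-newonly-table.txt d5a42e2a96e2a838 +
g15-eis2-4p-table.txt, summary 4502b08414cf8498, evidence on stmt-BirchSwinnertonDyer-22967): `p ≡ 5 (mod 8)`: **59/59**
levels `p ≤ 1429` have exactly one 2-Eisenstein (packet, λ) pair in all of `S₂(Γ₀(4p))` (none at levels `p`, `2p`: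
43/43), with `f = e = 1` — both statements hold in range, 0 violations; second engine (refuter-1 §R58, modular symbols):
`R(4p) ≤ 1` certified part-wise at the 8 primes `p ≡ 5 (mod 8)`, `p ≤ 109`.  REFUTER VERDICTS: refuter-1 §R58 (R-imc-33,
2026-08-28T10:55Z, HOME/ref1/R58-ref1-imc-g15.md aa26f61ef203f04d): E-imc-85ᵀ **SURVIVES**, E-imc-85U **SURVIVES** (BC7 CLEAN
HOME/ref1/R58-PHU.out 7b2e037de01fa272); refuter-2 R-imc-34 (placement) PENDING.  NOT IN PRINT: the `ℓ = 2` rank-one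
statement at level `4p` (asked in print for `ℓ ≥ 5` only — Yoo 2017 Q 1.1/Thm 1.3; level `p`: Mazur 1977, Calegari–Emerton
2005 Thm 1.1).  PARTITION 0 · beyond-print theorem: no · BSD is not proved by this; Manin's conjecture is not proved by this.
-/

set_option autoImplicit false

noncomputable section

open scoped MatrixGroups
open CongruenceSubgroup
open Literature.NumberTheory.EllipticCurves Literature.NumberTheory.EllipticCurves.ModularForms

namespace Summit.BirchSwinnertonDyer.Rank1Residual.ManinAdditive.TwoEisenstein

/-- The 2-EISENSTEIN ideal `𝔪₂ = (2, T_ℓ − (1 + ℓ) : ℓ ∤ N prime)` of the anemic Hecke ring `𝕋^{(N)} = ℤ[T_ℓ : ℓ ∤ N]`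
(tree `anemicHeckeRing N 2`, `Literature/NumberTheory/EllipticCurves/HeckeCongruenceModulus.lean`: commutative, finite free
over `ℤ`, Noetherian, finitely many minimal primes — all proved there).  A LEFT ideal = `Ideal` (`𝕋` is commutative).  If
proper it is THE unique maximal ideal of `𝕋` containing `2` at which every `T_ℓ ≡ 1 + ℓ` (`𝕋/𝔪₂ = 𝔽₂` is generated by the
images `T_ℓ ↦ 0`).  (imc g15 SketchU VERBATIM with imc's local `heckeAlg N := Algebra.adjoin ℤ {T_ℓ : ℓ ∤ N prime}` replaced
by the tree's `anemicHeckeRing N 2` — the SAME term, `Algebra.adjoin ℤ (anemicHeckeGenerators N 2)` with a syntactically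
identical generator set, so imc's and this file's Props agree by `Iff.rfl`, checked in
HOME/typer/Combined_T_imc_8_hecke_check.scratch.lean; refuter-1 RBU66.1: `2 ∈ 𝔪₂`.) -/
def eisIdealTwo (N : ℕ) [NeZero N] : Ideal (anemicHeckeRing N 2) :=
  Ideal.span {x | (x : Module.End ℂ (CuspForm (Gamma0 N) 2)) = 2 ∨
    ∃ (ℓ : ℕ) (hℓ : ℓ.Prime), ¬ ℓ ∣ N ∧
      (x : Module.End ℂ (CuspForm (Gamma0 N) 2)) =
        (haveI : NeZero ℓ := ⟨hℓ.ne_zero⟩; heckeT (Gamma0 N) 2 ℓ) - ((1 + ℓ : ℕ) : Module.End ℂ (CuspForm (Gamma0 N) 2))}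

/-- **(U)_Zar at level `N`** (`IsTwoEisensteinPacketUnique`): the 2-Eisenstein ideal is proper and exactly ONE prime of
`𝕋` is minimal among the primes it contains (= one newform or oldform PACKET meets `𝔪₂`; the Zariski shadow of es's
uniqueness hypothesis (U), which in addition asks that only one `λ ∣ 2` of that packet be Eisenstein).  (imc g15 SketchU
VERBATIM over `anemicHeckeRing N 2`.) -/
def IsTwoEisensteinPacketUnique (N : ℕ) [NeZero N] : Prop :=
  eisIdealTwo N ≠ ⊤ ∧
    ∀ P Q : Ideal (anemicHeckeRing N 2), P.IsPrime → Q.IsPrime → P ≤ eisIdealTwo N → Q ≤ eisIdealTwo N →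
      (∀ P' : Ideal (anemicHeckeRing N 2), P'.IsPrime → P' ≤ P → P' = P) →
      (∀ Q' : Ideal (anemicHeckeRing N 2), Q'.IsPrime → Q' ≤ Q → Q' = Q) → P = Q

/-- **`𝕋_{𝔪₂} = ℤ₂` at level `N`** (`IsTwoEisensteinRankOne`): (U)_Zar and `𝔪₂ 𝕋_{𝔪₂} = 2 𝕋_{𝔪₂}` (localised
divisibility `∀ x ∈ 𝔪₂, ∃ s ∉ 𝔪₂, ∃ t, s x = 2 t`): a reduced local ring whose maximal ideal is `(2)` and which has one
minimal prime is a DVR with uniformizer `2` and residue field `𝔽₂`, so its completion is `ℤ₂`; in particular es's full (U)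
follows.  (imc g15 SketchU VERBATIM over `anemicHeckeRing N 2`; refuter-1 RBU66.2: rank one ⟹ `𝔪₂ ≠ ⊤`; RBU66.3: the
divisibility clause is informative only for `x ∉ 2𝕋`.) -/
def IsTwoEisensteinRankOne (N : ℕ) [NeZero N] : Prop :=
  IsTwoEisensteinPacketUnique N ∧
    ∀ x ∈ eisIdealTwo N, ∃ s : anemicHeckeRing N 2, s ∉ eisIdealTwo N ∧ ∃ t : anemicHeckeRing N 2, s * x = 2 * t

/-- **Candidate E-imc-85ᵀ `FourPTwoEisensteinRankOneT` — for every prime `p ≡ 5 (mod 8)`, `𝕋(Γ₀(4p))_{𝔪₂} = ℤ₂`**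
(the DECIDING LAW of the lens in Hecke-algebra currency, Mazur's language; cell bsd-f2-manin, imc g15 SketchU; nothing
asserted).  BC5 (imc PKT census, FINAL-FOR-SESSION MEMO-imc §21.9, table HOME/imc/g15-eis2-newonly-table.txt
d5a42e2a96e2a838): **59/59** levels `4p`, `p ≡ 5 (mod 8)`, `p ≤ 1429`: exactly one 2-Eisenstein (packet, λ) pair in all
of `S₂(Γ₀(4p))` (none at levels `p`, `2p`: 43/43), with `f = e = 1` — 0 violations; cheapest falsifier: one `p ≡ 5 (mod 8)`
with two 2-Eisenstein packets or `e_λ = 2` (none in range).  Relation to E-imc-85 (`FourPTwoEisensteinRankOne`, the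
elementary line statement in `TwoEisensteinRankOneLaws.lean`): E-85 ⟹ E-85ᵀ (faithful action of `𝕋̂_𝔪` on `S(ℤ) ⊗ ℤ₂`),
converse automatic on `p ≡ 5 (mod 8)` (nothing old at `p`, `2p`: Mazur + E-imc-81) — refuter-1 §R58 F-1(c); neither
direction is kernel-proved.  NOT IN PRINT at `ℓ = 2`, level `4p` (the rank-one question is asked in print for `ℓ ≥ 5`
only: Yoo 2017, Q 1.1 and Thm 1.3; level `p`: Mazur 1977 + Calegari–Emerton 2005 Thm 1.1).  REF1 §R58 (R-imc-33):
**SURVIVES** (kernel HOME/ref1-CU66-imc-g15-audit.lean 2606c7fce688f566 rc 0, 0 sorries; BC7 CLEAN R58-PHU.out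
7b2e037de01fa272); refuter-2 R-imc-34 pending.  Consumers: es LEMMA-es-30 / A-imc-20 (via (U) below); C2 LEAD stub 6
(`RbTotallyBlindTame`) line «two-eisenstein-rank-one» (P-imc-3: `stub_U` may be this row).
[conjecture — cell candidate, NOT a tree fact]
[cite: Mazur1977, Prop. II.9.7 and §II.16 (shape only: the Eisenstein ideal and the structure of `𝕋_𝔪` at Eisenstein primes, prime level; the level-`4p`, `ℓ = 2` rank-one law is the cell's row E-imc-85ᵀ, NOT in print — MEMO-imc §21.9)] -/
@[conjecture]
def FourPTwoEisensteinRankOneT : Prop :=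
  ∀ (p : ℕ) [NeZero (4 * p)], p.Prime → p % 8 = 5 → IsTwoEisensteinRankOne (4 * p)

/-- **Candidate (U) = E-imc-85U `FourPTwoEisensteinPacketUniqueT` — for every prime `p ≡ 5 (mod 8)`, exactly one Hecke
packet of `S₂(Γ₀(4p))` is 2-Eisenstein** (es LEMMA-es-30's hypothesis, Zariski form; implied by E-imc-85ᵀ; cell
bsd-f2-manin, imc g15 SketchU for es A-imc-20; nothing asserted).  BC5: as E-imc-85ᵀ (59/59, 0 violations).  Caveat
(imc, refuter-1): (U)_Zar counts PACKETS — es's full (U) (a unique Eisenstein `λ ∣ 2` inside the packet) follows from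
E-imc-85ᵀ, not from (U)_Zar alone.  REF1 §R58: **SURVIVES**.
[conjecture — cell candidate, NOT a tree fact]
[cite: Mazur1977, Prop. II.9.7 (shape only: Eisenstein ideal, prime level; the level-`4p` packet-uniqueness law is the cell's row E-imc-85U, NOT in print)] -/
@[conjecture]
def FourPTwoEisensteinPacketUniqueT : Prop :=
  ∀ (p : ℕ) [NeZero (4 * p)], p.Prime → p % 8 = 5 → IsTwoEisensteinPacketUnique (4 * p)

/-- E-imc-85ᵀ ⟹ (U) (definitional; imc g15 SketchU `packetUnique_of_rankOne`, kernel-checked). -/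
theorem fourPTwoEisensteinPacketUniqueT_of_rankOneT (h : FourPTwoEisensteinRankOneT) :
    FourPTwoEisensteinPacketUniqueT :=
  fun p _ hp h8 ↦ (h p hp h8).1

/-! ### refuter-1's kernel read-back on the Hecke currency (REF1 §R58 RBU66.1–66.3, VERBATIM over `anemicHeckeRing N 2`) -/

/-- RBU66.1 (refuter-1): `2 ∈ 𝔪₂` (the generator is really there: the coercion `𝕋 → End` sends `2 ↦ 2`). -/
theorem two_mem_eisIdealTwo (N : ℕ) [NeZero N] : (2 : anemicHeckeRing N 2) ∈ eisIdealTwo N :=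
  Ideal.subset_span (Or.inl (map_ofNat (anemicHeckeRing N 2).val 2))

/-- RBU66.2 (refuter-1): rank one ⟹ `𝔪₂` proper (so `𝕋/𝔪₂ = 𝔽₂` is a genuine residue field). -/
theorem eisIdealTwo_ne_top_of_isTwoEisensteinRankOne (N : ℕ) [NeZero N] (h : IsTwoEisensteinRankOne N) :
    eisIdealTwo N ≠ ⊤ := h.1.1

/-- RBU66.3 (refuter-1): in `IsTwoEisensteinRankOne` the localised divisibility is only informative for `x ∉ 2𝕋`: for
`x = 2·t` the witness `s = 1` works as soon as `𝔪₂ ≠ ⊤` (bookkeeping of the quantifier shape). -/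
theorem rankOne_div_at_two_mul (N : ℕ) [NeZero N] (hne : eisIdealTwo N ≠ ⊤) (t : anemicHeckeRing N 2) :
    ∃ s : anemicHeckeRing N 2, s ∉ eisIdealTwo N ∧ ∃ t' : anemicHeckeRing N 2, s * (2 * t) = 2 * t' :=
  ⟨1, fun h1 ↦ hne ((Ideal.eq_top_iff_one _).mpr h1), t, by rw [one_mul]⟩

/-- `T_ℓ − (1 + ℓ) ∈ 𝔪₂` for every prime `ℓ ∤ N` (the other generators are really there too; uses the tree's
`anemicHeckeRing.T`). -/
theorem T_sub_mem_eisIdealTwo (N : ℕ) [NeZero N] (ℓ : ℕ) [NeZero ℓ] (hℓ : ℓ.Prime) (hℓN : ¬ ℓ ∣ N) :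
    anemicHeckeRing.T N 2 ℓ hℓ hℓN - ((1 + ℓ : ℕ) : anemicHeckeRing N 2) ∈ eisIdealTwo N := by
  refine Ideal.subset_span (Or.inr ⟨ℓ, hℓ, hℓN, ?_⟩)
  simp

end Summit.BirchSwinnertonDyer.Rank1Residual.ManinAdditive.TwoEisenstein

end
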